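import Summits.ResolutionOfSingularities.ResolutionOfSingularities.Theses.SectionAscent
import Summits.ResolutionOfSingularities.ResolutionOfSingularities.Theorems.SectionAscentAffineToGlobalModificationPatching
import Summits.ResolutionOfSingularities.ResolutionOfSingularities.Theorems.PAlterationPicoverKernelHonesty
import Summits.ResolutionOfSingularities.ResolutionOfSingularities.Theorems.SectionAscentAffineToGlobalAffineSingularLocus
import Summits.ResolutionOfSingularities.ResolutionOfSingularities.Theorems.SectionAscentAffineToGlobalStalkTransfer
import Summits.ResolutionOfSingularities.ResolutionOfSingularities.Theorems.SectionAscentAffineToGlobalRegularBaseLocalization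
import Summits.ResolutionOfSingularities.ResolutionOfSingularities.Theorems.SectionAscentAffineToGlobalYardstickModel
import Literature.AlgebraicGeometry.Resolution.BlowupsComposition
import Literature.AlgebraicGeometry.Resolution.QuasiProjectiveResolution
import HarnessLib

/-!
# Crux `AffineToGlobal` (stmt-ResolutionOfSingularities-15961), line `Sketch` (regular
# yardsticks): the crux CLOSED MODULO the regular kernel RIGreg

Route `ResolutionOfSingularities/SectionAscent`, crux `AffineToGlobal`
(`Summit.ResolutionOfSingularities.ResolutionOfSingularities.Theses.SectionAscent.AffineToGlobal`:
affine `Sing`-exact one-shot resolutions in characteristic `p`, all dimensions and all fields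
("H") ⇒ `ResolutionInChar p`). Support file (`--supports stmt-ResolutionOfSingularities-15961`):
the composition of the lead's skeleton `Cruxes/AffineToGlobal/Lines/Sketch.lean` with its three
TRUE stubs landed (`YardstickModel.stub_yardstickModel`, `StalkTransfer.stub_stalkTransfer`,
`RegularBaseLocalization.stub_regularBaseLocalization`), leaving the crux conditional on exactly
one statement, the REGULAR KERNEL

  RIGreg(p): for every integral `X` of finite type over a field of characteristic `p`, every
  REGULAR point `x ∈ X` and every blow-up `S' → Spec 𝒪_{X,x}` singular only over the closed
  point, `S'` admits a desingularization (a `Sing S'`-supported blow-up with regular source)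

— Temkin's condition (iii) of Prop. 2.3.4 (Temkin 2008) at regular stalks, i.e.
desingularization of rig-regular "sandwiched" singularities; it is implied by Temkin-strong
resolution `ResolutionOver (Spec K)` in characteristic `p`
(`Picover.KernelHonestyGeneral.localBlowupsAdmitDesingularization_of_resolutionOver`) and is
open from dimension 4 on.

**Proof of `resolutionInChar_of_regularKernel` (H ∧ RIGreg(p) ⇒ ResolutionInChar p).** By the
landed projective reduction (`WeightedThesis.ProjectiveIntegralSuffices`) it suffices to resolve
an integral `Y` of finite type over `k`. YARDSTICK MODEL (`stub_yardstickModel`, the only use of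
H): one-shots `R_i = Bl_{I_i} U_i` of a finite affine cover, maximal extensions `J_i` of their
centres, `S := Bl_{∏ J_i} Y`; over the chart `U_i` the model `S` is a blow-up of the REGULAR
integral variety `R_i` (Stacks 080A and uniqueness of blow-ups). PATCHING: the in-tree per-scheme
Temkin localisation (`Picover.LocalBlowups.admitsDesingularization_of_localBlowups_over_field`)
desingularizes `S` as soon as every blow-up of every local scheme `Spec 𝒪_{S,s}` admits a
desingularization; by `stub_stalkTransfer` (Stacks 080B + Temkin (ii)⇒(iii) per scheme) this
follows from "every blow-up of `R_i` admits a desingularization", which is Temkin's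
(iii)⇒(ii) run over the base `R_i` (`stub_regularBaseLocalization`) fed by RIGreg at the points
of the regular `R_i`. Finally a desingularization of the integral `S` is a resolution, `S → Y`
is proper birational, and `Scheme.HasResolution.of_isBirational`.

Recorded for the planner: the patching consumes only the WEAK form of H (some `I ≠ ⊥` with
`Bl_I` regular); the exactness `V(I) = Sing` enters only through the finitely-singular case of
the kernel (`AffineSingularLocus.stub_finiteSingularLocus`, landed), whence the variant
`affineToGlobal_of_regularKernel_infinite` asking RIGreg only for INFINITE singular loci.

## Sources

* M. Temkin, *Desingularization of quasi-excellent schemes in characteristic zero*, Adv. Math.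
  219 (2008), Prop. 2.3.4, Lemma 2.1.1, Lemma 2.1.4. [Temkin2008]
* The Stacks Project, Tags 080A, 080B. [StacksProject]
* V. Cossart, O. Piltant, *Resolution of singularities of arithmetical threefolds*, J. Algebra
  529 (2019), p. 3 (the blow-up form is open even for affine threefolds). [CossartPiltant2019]
-/

noncomputable section

set_option linter.dupNamespace false -- mandated namespace of this single-conjunct summit

open CategoryTheory CategoryTheory.Limits AlgebraicGeometry TopologicalSpace IsLocalRing
open Literature.AlgebraicGeometry.Resolution

namespace Summit.ResolutionOfSingularities.ResolutionOfSingularities.Theorems.AffineToGlobal.RegularYardstick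

/-- **Resolution of an integral variety from H and "blow-ups of regular varieties admit
desingularizations".** If affine one-shots exist in characteristic `p` (H) and every blow-up of
every regular integral `K`-scheme of finite type (`char K = p`) admits a desingularization, then
every integral `Y` of finite type over `K` has a resolution of singularities: yardstick model
`S → Y` (locally a blow-up of a regular variety), Temkin's localisation on `S` with local
hypothesis by the stalk transfer, desingularization ⇒ resolution, `S → Y` proper birational.
[cite: Temkin2008, Prop. 2.3.4] [cite: StacksProject, Tag 080B] -/
theorem hasResolution_of_regularBlowups (p : ℕ)
    (h : ∀ d : ℕ, ∀ (K : Type) [Field K] [CharP K p] (A : Type) [CommRing A] [IsDomain A]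
      [Algebra K A] [Algebra.FiniteType K A], ringKrullDim A < (d : WithBot ℕ∞) →
      ∃ I : Ideal A, I ≠ ⊥ ∧
        Literature.AlgebraicGeometry.Resolution.Scheme.IsRegular
          (Literature.AlgebraicGeometry.Resolution.affineBlowup I) ∧
        ∀ 𝔭 : PrimeSpectrum A, I ≤ 𝔭.asIdeal ↔
          ¬ IsRegularLocalRing (Localization.AtPrime 𝔭.asIdeal))
    (K : Type) [Field K] [CharP K p]
    (hreg : ∀ (R : Scheme.{0}) [IsIntegral R] (fR : R ⟶ Spec (.of K)) [LocallyOfFiniteType fR]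
      [QuasiCompact fR], Scheme.IsRegular R → ∀ (M : Scheme.{0}) (π : M ⟶ R)
      (J : R.IdealSheafData), IsBlowup π J → Scheme.AdmitsDesingularization M)
    (Y : Scheme.{0}) [IsIntegral Y] (f : Y ⟶ Spec (.of K)) [LocallyOfFiniteType f]
    [QuasiCompact f] : Scheme.HasResolution Y := by
  obtain ⟨S, σ, J, hJ, hσ, hlocal⟩ := YardstickModel.stub_yardstickModel p h K Y f
  haveI : IsLocallyNoetherian Y := LocallyOfFiniteType.isLocallyNoetherian f
  haveI : IsIntegral S := hσ.isIntegral hJ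
  haveI : IsProper σ := hσ.isProper
  haveI : LocallyOfFiniteType (σ ≫ f) := inferInstance
  haveI : QuasiCompact (σ ≫ f) := inferInstance
  have hdes : Scheme.AdmitsDesingularization S := by
    refine Theorems.Picover.LocalBlowups.admitsDesingularization_of_localBlowups_over_field K S
      (σ ≫ f) (fun s _ S' g I hg _ => ?_)
    obtain ⟨R, fR, _, _, _, P, ι', _, t, Q, hRreg, ht, ⟨p₀, rfl⟩⟩ := hlocal s
    haveI : IsLocallyNoetherian R := LocallyOfFiniteType.isLocallyNoetherian fR
    haveI : CompactSpace R := QuasiCompact.compactSpace_of_compactSpace fR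
    haveI : IsNoetherian R := {}
    exact StalkTransfer.stub_stalkTransfer R (fun M π J' hπ => hreg R fR hRreg M π J' hπ)
      P S t Q ht ι' p₀ S' g I hg
  haveI : IsLocallyNoetherian S := LocallyOfFiniteType.isLocallyNoetherian (σ ≫ f)
  exact Scheme.HasResolution.of_isBirational σ (hσ.isBirational' hJ) hdes.hasResolution

/-- **Resolution in characteristic `p` from H and the regular kernel RIGreg(p)** (the
composition of line `Sketch`): for regular integral `R` of finite type over `K`, RIGreg at the
points of `R` and Temkin's localisation over the base `R`
(`RegularBaseLocalization.stub_regularBaseLocalization`) make every blow-up of `R` admit a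
desingularization; then `hasResolution_of_regularBlowups` and the landed projective reduction
`WeightedThesis.ProjectiveIntegralSuffices.stub_projectiveIntegralSuffices`.
[cite: Temkin2008, Prop. 2.3.4] [cite: CossartPiltant2019, p. 3] -/
theorem resolutionInChar_of_regularKernel (p : ℕ)
    (h : ∀ d : ℕ, ∀ (K : Type) [Field K] [CharP K p] (A : Type) [CommRing A] [IsDomain A]
      [Algebra K A] [Algebra.FiniteType K A], ringKrullDim A < (d : WithBot ℕ∞) →
      ∃ I : Ideal A, I ≠ ⊥ ∧
        Literature.AlgebraicGeometry.Resolution.Scheme.IsRegular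
          (Literature.AlgebraicGeometry.Resolution.affineBlowup I) ∧
        ∀ 𝔭 : PrimeSpectrum A, I ≤ 𝔭.asIdeal ↔
          ¬ IsRegularLocalRing (Localization.AtPrime 𝔭.asIdeal))
    (hker : ∀ (K : Type) [Field K] [CharP K p] (X : Scheme.{0}) [IsIntegral X]
      (f : X ⟶ Spec (.of K)) [LocallyOfFiniteType f] [QuasiCompact f] (x : X),
      x ∈ Scheme.regularLocus X →
      ∀ (S' : Scheme.{0}) (g : S' ⟶ Spec (X.presheaf.stalk x))
        (I : (Spec (X.presheaf.stalk x)).IdealSheafData), IsBlowup g I →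
        (∀ s : S', s ∉ Scheme.regularLocus S' → g s = closedPoint (X.presheaf.stalk x)) →
        Scheme.AdmitsDesingularization S') :
    ResolutionInChar.{0} p := by
  intro k _ _ X f hsep hlft hqc hred
  refine Theorems.WeightedThesis.ProjectiveIntegralSuffices.stub_projectiveIntegralSuffices k
    (fun n Y ι hι hint => ?_) X f hsep hlft hqc hred
  haveI := hι
  haveI := hint
  haveI : IsProper (Literature.AlgebraicGeometry.Motives.projectiveSpace n k).hom :=
    Literature.AlgebraicGeometry.Motives.isProper_projectiveSpace n k
  let fY : Y ⟶ Spec (.of k) := ι ≫ (Literature.AlgebraicGeometry.Motives.projectiveSpace n k).hom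
  haveI : LocallyOfFiniteType fY := inferInstance
  haveI : QuasiCompact fY := inferInstance
  refine hasResolution_of_regularBlowups p h k (fun R _ fR _ _ hRreg M π J' hπ => ?_) Y fY
  exact RegularBaseLocalization.stub_regularBaseLocalization k R fR
    (fun x S'' g' I' hg' hs' => hker k R fR x ((Scheme.mem_regularLocus x).mpr (hRreg x))
      S'' g' I' hg' hs') M π J' hπ

/-- **The crux `AffineToGlobal` modulo the regular kernel RIGreg**: if, prime by prime, the
crux's hypothesis H implies RIGreg(p) (Temkin's condition (iii) of Prop. 2.3.4 at REGULAR
stalks of characteristic-`p` varieties), then `SectionAscent.AffineToGlobal` holds. This is a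
CONDITIONAL result: its hypothesis is the registered open stub `stub_regularKernel` of line
`Sketch` (without the idle finiteness guard), an open problem from dimension 4 on (and in its
blow-up form from dimension 3, Cossart–Piltant 2019, p. 3).
[cite: Temkin2008, Prop. 2.3.4] [cite: CossartPiltant2019, p. 3] -/
theorem affineToGlobal_of_regularKernel
    (hker : ∀ p : ℕ, p.Prime →
      (∀ d : ℕ, ∀ (K : Type) [Field K] [CharP K p] (A : Type) [CommRing A] [IsDomain A]
        [Algebra K A] [Algebra.FiniteType K A], ringKrullDim A < (d : WithBot ℕ∞) →
        ∃ I : Ideal A, I ≠ ⊥ ∧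
          Literature.AlgebraicGeometry.Resolution.Scheme.IsRegular
            (Literature.AlgebraicGeometry.Resolution.affineBlowup I) ∧
          ∀ 𝔭 : PrimeSpectrum A, I ≤ 𝔭.asIdeal ↔
            ¬ IsRegularLocalRing (Localization.AtPrime 𝔭.asIdeal)) →
      ∀ (K : Type) [Field K] [CharP K p] (X : Scheme.{0}) [IsIntegral X]
        (f : X ⟶ Spec (.of K)) [LocallyOfFiniteType f] [QuasiCompact f] (x : X),
        x ∈ Scheme.regularLocus X →
        ∀ (S' : Scheme.{0}) (g : S' ⟶ Spec (X.presheaf.stalk x))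
          (I : (Spec (X.presheaf.stalk x)).IdealSheafData), IsBlowup g I →
          (∀ s : S', s ∉ Scheme.regularLocus S' → g s = closedPoint (X.presheaf.stalk x)) →
          Scheme.AdmitsDesingularization S') :
    Summit.ResolutionOfSingularities.ResolutionOfSingularities.Theses.SectionAscent.AffineToGlobal :=
  fun p hp hH => resolutionInChar_of_regularKernel p hH (hker p hp hH)

/-- **The crux `AffineToGlobal` modulo the regular kernel in its INFINITE case only** (the
registered stub `stub_regularKernel` of line `Sketch`, verbatim as hypothesis): blow-ups of
local schemes at regular points that are singular at finitely many points only are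
desingularized by H alone (`AffineSingularLocus.stub_finiteSingularLocus`, landed), so RIGreg
is needed only for infinite singular loci. [cite: Temkin2008, Prop. 2.3.4] -/
theorem affineToGlobal_of_regularKernel_infinite
    (hker : ∀ p : ℕ, p.Prime →
      (∀ d : ℕ, ∀ (K : Type) [Field K] [CharP K p] (A : Type) [CommRing A] [IsDomain A]
        [Algebra K A] [Algebra.FiniteType K A], ringKrullDim A < (d : WithBot ℕ∞) →
        ∃ I : Ideal A, I ≠ ⊥ ∧
          Literature.AlgebraicGeometry.Resolution.Scheme.IsRegular
            (Literature.AlgebraicGeometry.Resolution.affineBlowup I) ∧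
          ∀ 𝔭 : PrimeSpectrum A, I ≤ 𝔭.asIdeal ↔
            ¬ IsRegularLocalRing (Localization.AtPrime 𝔭.asIdeal)) →
      ∀ (K : Type) [Field K] [CharP K p] (X : Scheme.{0}) [IsIntegral X]
        (f : X ⟶ Spec (.of K)) [LocallyOfFiniteType f] [QuasiCompact f] (x : X),
        x ∈ Scheme.regularLocus X →
        ∀ (S' : Scheme.{0}) (g : S' ⟶ Spec (X.presheaf.stalk x))
          (I : (Spec (X.presheaf.stalk x)).IdealSheafData), IsBlowup g I →
          (∀ s : S', s ∉ Scheme.regularLocus S' → g s = closedPoint (X.presheaf.stalk x)) →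
          (Scheme.regularLocus S')ᶜ.Infinite → Scheme.AdmitsDesingularization S') :
    Summit.ResolutionOfSingularities.ResolutionOfSingularities.Theses.SectionAscent.AffineToGlobal :=
  fun p hp hH => resolutionInChar_of_regularKernel p hH
    (fun K _ _ X _ f _ _ x hx S' g I hg hs => by
      by_cases hfin : (Scheme.regularLocus S')ᶜ.Finite
      · exact AffineSingularLocus.stub_finiteSingularLocus p hp hH K X f x S' g I hg hfin
      · exact hker p hp hH K X f x hx S' g I hg hs hfin)

end Summit.ResolutionOfSingularities.ResolutionOfSingularities.Theorems.AffineToGlobal.RegularYardstick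

end
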